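import Summits.Parity.BatemanHorn.Theorems.RoughValueTransportBalancedSemiprimeLayerOfRelativeSplit
import HarnessLib

/-!
# Crux `BalancedSemiprimeLayer` (stmt-Parity-9469), line `Ideator4Sketch` = card `relative-mass-split`
# (round 2, ideator 4) — SKELETON r4 (r3 by lead a1, prover-line-stmt-Parity-9469-a1-0, 2026-08-16; re-owned verbatim by seats c3/c4, 2026-08-16;
# r4 = r3 + bookkeeping stub S7 by seat c5, prover-line-stmt-Parity-9469-c5-0, 2026-08-17; re-owned verbatim by seats c6, c7, c8, c9 and c10 (prover-line-stmt-Parity-9469-c10-0), 2026-08-17,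
# stubs S4/S5 unchanged)

Book the `k`-dimensional sieve of the landed lever (`stub_sifted_le` p104339 → `stub_roughWindowLever`
p107548) against the ACTUAL window-incidence mass `X = Σ_{m ∈ RW} P(x; m, 1)` instead of the predicted
`x·Σ_m ρᵢ(m)/m`.  The residual S8 `stub_roughWindowRootLevel_highDegree` (absolute root level; every
round-1 line died there) then SPLITS into

* H1 (`stub_windowMass_highDegree`): the window mass is `O(δx)` with a `δ`-free constant — an anatomy
  statement with no class, no root count `ρ`, no main term (the card's `WindowMass`, displayed unfolded);
* H2 (`stub_relativeRootLevel_highDegree`): MAIN-TERM-FREE equidistribution of the window incidences over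
  the classes `n ≡ s (mod e)`, `e ≤ x^c` squarefree, power saving (the card's `RelativeRootLevel`, unfolded);

both for ONE irreducible `g` of degree `≥ 3` with positive leading coefficient (degrees `≤ 2` are the landed
`layerConclusion_of_natDegree_le_two` inside `stub_transfer`, p78616).  Everything is stated over EXISTING
tree vocabulary (`roughDivWindow`, `posRange`, `windowPairCount`, `polyRootCountMod`, `coordLayer`,
`CoordLayerThin`); nothing new is defined, so that the two open atoms can be filed verbatim.

r1 → r2 (integration 1, 22:3xZ): S1 `stub_relativeSiftedLe` LANDED p127967
(`Theorems/…RelativeSieveStep.lean`), S2 `stub_relativeTransfer` LANDED p128158 (`…RelativeTransfer.lean`),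
S3 `stub_relativeLeverOfStep` LANDED p127985 (`…RelativeLever.lean`) — imported, no longer stubs.  New
registered glue stub S6 `stub_higherLayerOfSplit` (H1-family → H2-family → the higher layer `CoordLayerThin`
for every coordinate of degree `≥ 3`, provable NOW from the three landed files; it lands together with the
displayed-hypotheses tree theorem `balancedSemiprimeLayer_of_relativeSplit` in `Theorems/…OfRelativeSplit.lean`).
r2 → r3 (integration 2, 22:5xZ): S6 `stub_higherLayerOfSplit` LANDED p129451 (`Theorems/…OfRelativeSplit.lean`, with
`balancedSemiprimeLayer_of_relativeSplit` = the card's `CruxOfSplit` and `SplitOfAbsolute`: S8 ⟹ H2 for every `g`,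
S8 ⟹ H1 for one-member Bateman–Horn systems) — imported.  Open: S4 (H1), S5 (H2) — no supplier (dead zone);
every other obligation of the line is a tree theorem.

r3 → r4 (seat c5, 2026-08-17): bookkeeping stub S7 `stub_windowMassDeltaBlind` (the δ-blind half of H1, not used by the
composition) registered and LANDED p137747 (`Theorems/…WindowMassTrivial.lean`) — no longer a stub (r4.2 drops it from this file).

Stubs (registered): S4 `stub_windowMass_highDegree` (OPEN), S5 `stub_relativeRootLevel_highDegree` (OPEN);
landed this line: S1 p127967, S2 p128158, S3 p127985, S6 p129451, S7 p137747;
`BalancedSemiprimeLayer_of = balancedSemiprimeLayer_of_relativeSplit S4 S5` — the crux BY NAME, modulo the two atoms.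
-/

noncomputable section

open Polynomial Filter Finset
open Literature.NumberTheory.Sieve
open scoped BigOperators

namespace Summit.Parity.BatemanHorn.Cruxes.BalancedSemiprimeLayer.RelativeMassSplit

open Summit.Parity.BatemanHorn.Theses.RoughValueTransport (BalancedSemiprimeLayer)
open Summit.Parity.BatemanHorn.Cruxes.BalancedSemiprimeLayer.RoughRelaxedDivisorSieve
  (roughDivWindow divWindow posRange windowPairCount)
open Summit.Parity.BatemanHorn.Cruxes.BalancedSemiprimeLayer.SmoothModulusTwistedHooley
  (coordLayer CoordLayerThin)

/-! ### S4, S5 — the two atoms (degree ≥ 3; OPEN) -/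

/-- **S4 `stub_windowMass_highDegree` — H1, the anatomy atom (the card's `WindowMass`, unfolded).**  For an
irreducible `g` of degree `d ≥ 3` with positive leading coefficient: `∃ c₀ > 0 ∀ 0 < c ≤ c₀ ∃ C ∀ 0 < δ ≤ c`,
eventually in `x`, `Σ_{m ∈ roughDivWindow d δ c x} #{1 ≤ n ≤ x : m ∣ g(n)} ≤ C·δ·x` — only `O(δx)` of the
`n ≤ x` carry an `x^c`-rough squarefree divisor of `g(n)` in the balanced window
`[x^{d(1−δ)/2}, x^{d(1+δ)/2}]`, with a `δ`-FREE constant (random model `C ≍ d²/c²`; S8 implies it by anchor B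
p102251).  STATUS: OPEN — the window lies in the dead zone `(1 + c_LPF, d − 1 − c_LPF)` of the large-prime
mass profile (nothing below the trivial bound is in print for any cubic); the lead holds this stub. [folklore] -/
theorem stub_windowMass_highDegree :
    ∀ g : ℤ[X], Irreducible g → 0 < g.leadingCoeff → 3 ≤ g.natDegree →
      ∃ c₀ : ℝ, 0 < c₀ ∧ ∀ c : ℝ, 0 < c → c ≤ c₀ → ∃ C : ℝ, ∀ δ : ℝ, 0 < δ → δ ≤ c →
        ∀ᶠ x : ℕ in atTop,
          (∑ m ∈ roughDivWindow g.natDegree δ c x,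
            (#((Ioc 0 x).filter fun n : ℕ => (m : ℤ) ∣ g.eval (n : ℤ)) : ℝ)) ≤ C * δ * x := by
  sorry

/-- **S5 `stub_relativeRootLevel_highDegree` — H2, relative root level (the card's `RelativeRootLevel`,
unfolded).**  For an irreducible `g` of degree `d ≥ 3` with positive leading coefficient:
`∃ c₀ > 0 ∀ 0 < c ≤ c₀ ∀ 0 < δ ≤ c ∃ η > 0`, eventually in `x`,
`Σ_{e ≤ x^c sqfree} Σ_{s mod e} |Σ_{m ∈ roughDivWindow d δ c x} (#{1 ≤ n ≤ x : n ≡ s (e), m ∣ g(n)} −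
#{1 ≤ n ≤ x : m ∣ g(n)}/e)| ≤ x^{1−η}` — the window incidences are equidistributed over the classes mod `e`
RELATIVE to their actual number (no `ρ_g`, no `x/e` main term; S8 implies it by the triangle inequality).
STATUS: OPEN (root distribution modulo `m ≍ x^{d/2} > x` counted in `[1, x]`; worker wave 1:
`stub-blocked: none-in-tree`). [folklore] -/
theorem stub_relativeRootLevel_highDegree :
    ∀ g : ℤ[X], Irreducible g → 0 < g.leadingCoeff → 3 ≤ g.natDegree →
      ∃ c₀ : ℝ, 0 < c₀ ∧ ∀ c : ℝ, 0 < c → c ≤ c₀ → ∀ δ : ℝ, 0 < δ → δ ≤ c →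
        ∃ η : ℝ, 0 < η ∧ ∀ᶠ x : ℕ in atTop,
          (∑ e ∈ (Icc 1 ⌊(x : ℝ) ^ c⌋₊).filter Squarefree, ∑ s ∈ range e,
            |∑ m ∈ roughDivWindow g.natDegree δ c x,
              ((#((Ioc 0 x).filter fun n : ℕ => n ≡ s [MOD e] ∧ (m : ℤ) ∣ g.eval (n : ℤ)) : ℝ) -
                (#((Ioc 0 x).filter fun n : ℕ => (m : ℤ) ∣ g.eval (n : ℤ)) : ℝ) / e)|) ≤
            (x : ℝ) ^ (1 - η) := by
  sorry

/-! ### S7 — LANDED (p137747): `RelativeMassSplit.stub_windowMassDeltaBlind` / `windowMass_le_two_pow_mul`, the δ-blind half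
of H1 (`Σ_{m ∈ roughDivWindow d δ c x} #{1 ≤ n ≤ x : m ∣ g(n)} ≤ 2^{⌊(d+1)/c⌋}·x` eventually, every real `δ`), tree file
`Theorems/RoughValueTransportBalancedSemiprimeLayerWindowMassTrivial.lean` (not imported here: bookkeeping, unused by the
composition); H1 (S4) = the same with `C·δ` in place of `2^{⌊(d+1)/c⌋}`. -/

/-! ### The composition: the crux BY NAME -/

/-- **The crux from the two atoms.**  `BalancedSemiprimeLayer` = the LANDED `balancedSemiprimeLayer_of_relativeSplit`
(p129451: `stub_transfer` p78616 at the relative lever p127985/p127967/p128158) applied to H1 (S4) and H2 (S5);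
`sorryAx` enters exactly through the two open atoms. -/
theorem BalancedSemiprimeLayer_of : BalancedSemiprimeLayer :=
  balancedSemiprimeLayer_of_relativeSplit stub_windowMass_highDegree stub_relativeRootLevel_highDegree

end Summit.Parity.BatemanHorn.Cruxes.BalancedSemiprimeLayer.RelativeMassSplit

end
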